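import Literature.Computability.Cryptography.QuantumCircuit
import Literature.Computability.Complexity.TokenStreams
import HarnessLib

/-!
# Token streams of circuit descriptions

The output encoder of the uniformity condition `QCircuitFamily.IsUniform` is
`QCircuit.sigmaEncode ⟨n, m, C⟩ = boolPair (encodeNat n) (boolPair (unaryEncodeNat m)
(encode C))`, a nest of `boolPair`s in which wire indices and gate symbols appear as
`encodeNat` binary numerals, doubled or quadrupled by the enclosing pairings. This file
spells that string out as a **token stream** for the renderer `Tok.render` of
`Literature.Computability.Complexity.TokenStreams` — every numeral in *unary* (`tickᵛ`)
closed by a `dump` of bit multiplicity `2` or `4` (`unaryTok v q`), every structural bit as a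
literal (`lits`) — and proves

* `render_descTok : Tok.render 0 (descTok n m C) = sigmaEncode ⟨n, m, C⟩`;
* `QCircuitFamily.isUniform_of_render_mem_FP`: a family is uniform as soon as
  `z ↦ Tok.render 0 (descTok |z| (F.ancillas |z|) (F.circ |z|))` is in `FP`, and
  `QCircuitFamily.isUniform_of_gen`: in particular as soon as a generator program
  (`GenPrograms.lean`) generates `n ↦ descTok n (F.ancillas n) (F.circ n)`
  (`GStmt.render_out_mem_FP`).

So a uniformity proof only has to *generate* the description with unary counters and prove a
list identity (`P`-uniformity is Arora–Barak 2009, Def. 6.12: a polynomial-time TM that on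
input `1ⁿ` outputs the description of `Cₙ`; writing the description with counters over gates
and wires is our paraphrase of the proof of their Thm. 6.6 with Remark 6.7).

## References

* S. Arora, B. Barak, *Computational Complexity: A Modern Approach*, CUP 2009, §0.1
  (pairing, representations), §6.1 (circuit descriptions), §6.2 Def. 6.12 (`P`-uniform
  circuit families), Thm. 6.13, Remark 6.7.
* A. C.-C. Yao, *Quantum circuit complexity*, FOCS 1993 (uniform quantum circuit families).
-/

namespace Literature.Computability.Cryptography

open _root_.Computability Complexity

variable {G : QGateSet} {n m : ℕ}

/-! ### Vocabulary: literals, unary numerals, stuttering -/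

/-- Literal bits as tokens. [folklore] -/
def lits (l : List Bool) : List Tok := l.map Tok.lit

/-- The numeral `v` in unary: `v` ticks closed by a dump of bit multiplicity `2` (`q = false`,
one enclosing `boolPair`) or `4` (`q = true`, two enclosing `boolPair`s). [folklore] -/
def unaryTok (v : ℕ) (q : Bool) : List Tok := List.replicate v Tok.tick ++ [Tok.dump q true]

/-- Mathlib's unary numeral is `1ⁿ` (a private copy of the lemma of `TautCertificates.lean`,
whose import cone is not needed here). [folklore] -/
private theorem unaryEncodeNat_eq_replicate (n : ℕ) : unaryEncodeNat n = List.replicate n true := by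
  induction n with
  | zero => rfl
  | succ n ih => rw [unaryEncodeNat, ih, List.replicate_succ]

/-- `lits` of a concatenation. [folklore] -/
@[simp] theorem lits_append (a b : List Bool) : lits (a ++ b) = lits a ++ lits b := List.map_append

/-- Repeating every bit `m` times. [folklore] -/
def stutter (m : ℕ) (l : List Bool) : List Bool := l.flatMap fun b => List.replicate m b

/-- `stutter` of `nil`. [folklore] -/
@[simp] theorem stutter_nil (m : ℕ) : stutter m [] = [] := rfl

/-- `stutter` of `cons`. [folklore] -/
@[simp] theorem stutter_cons (m : ℕ) (b : Bool) (l : List Bool) :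
    stutter m (b :: l) = List.replicate m b ++ stutter m l := rfl

/-- The numerals of `TokenStreams` are stuttered binary numerals. [folklore] -/
theorem numeral_eq_stutter (m c : ℕ) : Tok.numeral m c = stutter m (encodeNat c) := rfl

/-- The bit multiplicity of the dump closing `unaryTok v false` is `2`, of `unaryTok v true`
is `4`. [folklore] -/
theorem mult_true_right (q : Bool) : Tok.mult q true = if q then 4 else 2 := by cases q <;> rfl

/-- Rendering literal bits. [folklore] -/
theorem render_lits (c : ℕ) (l : List Bool) (ts : List Tok) :
    Tok.render c (lits l ++ ts) = l ++ Tok.render c ts :=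
  Tok.render_map_lit c l ts

/-- Rendering a unary numeral from counter `0`: the stuttered binary numeral, and the counter is
reset. [folklore] -/
theorem render_unaryTok (v : ℕ) (q : Bool) (ts : List Tok) :
    Tok.render 0 (unaryTok v q ++ ts) = stutter (Tok.mult q true) (encodeNat v) ++ Tok.render 0 ts := by
  rw [unaryTok, List.append_assoc, List.singleton_append, Tok.render_numeral, numeral_eq_stutter]

/-! ### Token streams -/

/-- The doubled separator `0 1` of a `boolPair` one level down: `0 0 1 1`. [folklore] -/
def sep2 : List Tok := lits [false, false, true, true]

/-- Tokens of the wire list of a placed gate: each index quadrupled-binary, then `0 0 1 1`.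
[cite: AroraBarakCC2009, §6.1] -/
def wiresTok (ws : List ℕ) : List Tok := ws.flatMap fun w => unaryTok w true ++ sep2

/-- **Tokens of a placed gate** (`boolPair`ed into the circuit encoding, hence everything one
level down: bits doubled, inner numerals quadrupled): tag bit, symbol code, arity in unary,
wire indices, closing separator. [cite: AroraBarakCC2009, §6.1] -/
def gateTok [Encodable G.Op] : QGate G n → List Tok
  | .gate g e =>
    lits [false, false] ++ unaryTok (Encodable.encode g) true ++ sep2 ++
      lits (List.replicate (4 * G.arity g) true) ++ sep2 ++
        wiresTok (List.ofFn fun i => (e i : ℕ)) ++ lits [false, true]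
  | .oracle k e =>
    lits [true, true] ++ unaryTok k true ++ sep2 ++
      lits (List.replicate (4 * (k + 1)) true) ++ sep2 ++
        wiresTok (List.ofFn fun i => (e i : ℕ)) ++ lits [false, true]

/-- Tokens of a circuit: its gates in order. [cite: AroraBarakCC2009, §6.1] -/
def circTok [Encodable G.Op] (C : QCircuit G n) : List Tok := C.gates.flatMap gateTok

/-- **Tokens of a circuit description** `⟨n, m, C⟩`: `n` in doubled binary, `m` in doubled
unary, then the gates. [cite: AroraBarakCC2009, §6.1] -/
def descTok [Encodable G.Op] (n m : ℕ) (C : QCircuit G (n + m)) : List Tok :=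
  unaryTok n false ++ lits [false, true] ++ lits (List.replicate (2 * m) true) ++
    lits [false, true] ++ circTok C

/-! ### Rendering the token streams -/

/-- `boolPair` is doubling, separator, payload. [folklore] -/
theorem boolPair_eq_stutter (x y : List Bool) : boolPair x y = stutter 2 x ++ [false, true] ++ y := rfl

/-- `stutter` distributes over concatenation. [folklore] -/
theorem stutter_append (k : ℕ) (a b : List Bool) : stutter k (a ++ b) = stutter k a ++ stutter k b := by
  simp [stutter]

/-- Doubling twice is quadrupling. [folklore] -/
theorem stutter_two_stutter_two (l : List Bool) : stutter 2 (stutter 2 l) = stutter 4 l := by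
  induction l with
  | nil => rfl
  | cons b l ih => rw [stutter_cons, stutter_append, ih, stutter_cons]; rfl

/-- Doubling a block of `true`s. [folklore] -/
theorem stutter_replicate (k v : ℕ) (b : Bool) :
    stutter k (List.replicate v b) = List.replicate (k * v) b := by
  induction v with
  | zero => simp
  | succ v ih => rw [List.replicate_succ, stutter_cons, ih, ← List.replicate_add]; congr 1; ring

/-- Rendering the wire tokens gives the doubled list encoding of the wire indices, without
its (doubled) unary length header. [folklore] -/
theorem render_wiresTok (ws : List ℕ) (ts : List Tok) :
    Tok.render 0 (wiresTok ws ++ ts) =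
      stutter 2 (ws.foldr (fun w acc => boolPair (encodeNat w) acc) []) ++ Tok.render 0 ts := by
  induction ws with
  | nil => rfl
  | cons w ws ih =>
    rw [wiresTok, List.flatMap_cons, List.append_assoc, ← wiresTok, List.append_assoc,
      render_unaryTok, sep2, render_lits, ih, List.foldr_cons, boolPair_eq_stutter,
      stutter_append, stutter_append, stutter_two_stutter_two]
    simp [stutter, List.replicate]

variable [Encodable G.Op]

/-- **Rendering the tokens of a gate gives its doubled encoding followed by the separator**
(its contribution to `QCircuit.encode`). [cite: AroraBarakCC2009, §6.1] -/
theorem render_gateTok (g : QGate G n) (ts : List Tok) :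
    Tok.render 0 (gateTok g ++ ts) = boolPair g.encode (Tok.render 0 ts) := by
  cases g with
  | gate g e =>
    simp only [gateTok, List.append_assoc]
    rw [render_lits, render_unaryTok, sep2, render_lits, render_lits, render_lits,
      render_wiresTok, render_lits, QGate.encode, boolPair_eq_stutter, boolPair_eq_stutter]
    simp only [stutter_cons, stutter_append, stutter_two_stutter_two, Encoding.listBool,
      encodingListNatBool, boolPair_eq_stutter, unaryEncodeNat_eq_replicate, List.length_ofFn,
      stutter_replicate, encodingNatBool]
    simp [List.replicate, stutter, List.append_assoc]
    omega
  | oracle k e =>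
    simp only [gateTok, List.append_assoc]
    rw [render_lits, render_unaryTok, sep2, render_lits, render_lits, render_lits,
      render_wiresTok, render_lits, QGate.encode, boolPair_eq_stutter, boolPair_eq_stutter]
    simp only [stutter_cons, stutter_append, stutter_two_stutter_two, Encoding.listBool,
      encodingListNatBool, boolPair_eq_stutter, unaryEncodeNat_eq_replicate, List.length_ofFn,
      stutter_replicate, encodingNatBool]
    simp [List.replicate, stutter, List.append_assoc]
    omega

/-- Rendering the tokens of a list of gates gives their `foldr boolPair`. [folklore] -/
theorem render_flatMap_gateTok (gs : List (QGate G n)) (ts : List Tok) :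
    Tok.render 0 (gs.flatMap gateTok ++ ts) =
      gs.foldr (fun g acc => boolPair g.encode acc) (Tok.render 0 ts) := by
  induction gs with
  | nil => rfl
  | cons g gs ih => rw [List.flatMap_cons, List.append_assoc, render_gateTok, ih, List.foldr_cons]

/-- **Rendering the tokens of a circuit gives its encoding.** [cite: AroraBarakCC2009, §6.1] -/
theorem render_circTok (C : QCircuit G n) : Tok.render 0 (circTok C) = C.encode := by
  rw [circTok, ← List.append_nil (C.gates.flatMap gateTok), render_flatMap_gateTok]
  rfl

/-- **Rendering the description tokens gives `sigmaEncode`.** [cite: AroraBarakCC2009, §6.1] -/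
theorem render_descTok (n m : ℕ) (C : QCircuit G (n + m)) :
    Tok.render 0 (descTok n m C) = QCircuit.sigmaEncode ⟨n, m, C⟩ := by
  rw [descTok, List.append_assoc, List.append_assoc, List.append_assoc,
    render_unaryTok, render_lits, render_lits, render_lits, render_circTok,
    QCircuit.sigmaEncode, boolPair_eq_stutter, boolPair_eq_stutter, unaryEncodeNat_eq_replicate,
    stutter_replicate]
  simp [List.append_assoc]

/-! ### Uniformity from a polynomial-time token generator -/

/-- **Uniformity via rendered tokens.** If `z ↦ Tok.render 0 (descTok |z| …)` is in `FP`,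
then `F` is uniform: on the input `1ⁿ` (of length `n`) that machine writes
`sigmaEncode ⟨n, F.ancillas n, F.circ n⟩` (`render_descTok`). [cite: AroraBarakCC2009, §6.2 Def. 6.12] -/
theorem QCircuitFamily.isUniform_of_render_mem_FP (F : QCircuitFamily G)
    (h : (fun z : List Bool => Tok.render 0 (descTok z.length (F.ancillas z.length)
      (F.circ z.length))) ∈ FP) : F.IsUniform := by
  obtain ⟨p, M, hM⟩ := h
  refine ⟨p, M, fun n => ?_⟩
  have h1 := hM (unaryEncodeNat n)
  have hl : (unaryEncodeNat n).length = n := by simp [unaryEncodeNat_eq_replicate]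
  simp only [id_eq] at h1
  rw [hl, render_descTok] at h1
  dsimp only
  rw [hl]
  exact h1

/-- **Uniformity via a generator program.** If a generator program `s` (`GenPrograms.lean`;
loop indices avoiding the input variable `x₀` and never reused) generates the description
stream `n ↦ descTok n (F.ancillas n) (F.circ n)`, then `F` is uniform
(`GStmt.render_out_mem_FP`: generating and rendering is polynomial-time; `P`-uniformity in
the sense of Arora–Barak 2009, Def. 6.12). [cite: AroraBarakCC2009, §6.2 Def. 6.12] -/
theorem QCircuitFamily.isUniform_of_gen (F : QCircuitFamily G) {V : Type} [DecidableEq V]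
    [Fintype V] (s : GStmt V Tok) (x₀ : V) (hx : x₀ ∉ s.loopVars) (hs : s.noReuse = true)
    (hout : ∀ n, s.out (GenProg.initEnv x₀ n) = descTok n (F.ancillas n) (F.circ n)) :
    F.IsUniform := by
  refine F.isUniform_of_render_mem_FP ?_
  have h := GStmt.render_out_mem_FP s x₀ hx hs
  have e : (fun z : List Bool => Tok.render 0 (s.out (GenProg.initEnv x₀ z.length))) =
      fun z => Tok.render 0 (descTok z.length (F.ancillas z.length) (F.circ z.length)) :=
    funext fun z => by rw [hout]
  rw [e] at h
  exact h

end Literature.Computability.Cryptography
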